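import Summits.BirchSwinnertonDyer.BirchSwinnertonDyer.Theses.ErratumRoadFive
import Summits.BirchSwinnertonDyer.BirchSwinnertonDyer.Theorems.ErratumRoadFiveJSWSigmaLocalCharIdeal
import HarnessLib
-- (buildfix 2026-08-28) explicit import: the route file's 03:58Z re-render no longer brings this module transitively
import Summits.BirchSwinnertonDyer.BirchSwinnertonDyer.Theorems.ErratumRoadFiveIMCDivRoadFFFittingFrameBOfMembers

/-!
# Route `ErratumRoadFive` (rung K2, `p ≥ 5`): the crux `IMCDivAtErratumDataAllR` (item stmt-BirchSwinnertonDyer-20169) and the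
# parent `OpenInputIMC` (item 19061) BY NAME from the route's OWN ITEMS — every PUBLISHED-but-algebraic input DISCHARGED

Cell `bsd-stepL` (run/shared/lean/pub/bsd-stepL/), seat `bsd-stepL-imc-p1` (prover g15, 2026-08-27);
`--supports stmt-BirchSwinnertonDyer-20169 --as helper`. This module imports the route file (its hypotheses and
conclusions ARE route decls, by name), so no `_holds` link can be stated here.

## What this file proves and why it exists

The Road-FF cone of K2 (`closes`, rev 40, `have h3 …`) derives the re-oriented divisibility `IMCDivAtErratumDataAllR` from
`(hMem : CastellaErratumMemberPackage) (hloc : JSWSigmaLocalCharIdeal)` + Shapiro + `(h331) (hF.2.1) (hF.2.2.2.1)`. Since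
2026-08-27 two of these inputs are THEOREMS of the tree: Shapiro ([SU14] Prop. 3.2.3,
`SkinnerUrban2014.prop323_XAc_equiv_XBigDecomp_holds`, p541834) and the local `Σ`-atom (support item 20495 `JSWSigmaLocalCharIdeal`,
CLOSED `proved` by `Theorems.jswSigmaLocalCharIdeal_holds`, p585440). This file records the resulting certificates with the
MINIMAL hypothesis lists, each hypothesis an ITEM of the route BY NAME:

* **`imcDivAtErratumDataAllR_of_memberPackage`** — crux 20169 ⟸ crux 20529 `CastellaErratumMemberPackage` (the ONE OPEN input, O15)
  + support 19626 `JSWAnticyclotomicControlMult` + the two published conjuncts GZK ∕ modularity; and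
  **`imcDivAtErratumDataAllR_of_memberPackage_of_items`** — the same keyed to support 19283 `PublishedInputsIMCReduction`
  (GZK = conjunct 2, modularity = conjunct 4): `20169 ⟸ 20529 + 19626 + 19283`.
* **`openInputIMC_of_memberPackage_of_rest3_of_notRam`** — the PARENT 19061 `OpenInputIMC` (THE open input of route p2 at every
  X11b pair, `p ≥ 5`) ⟸ `20529 + 19625 + 19283 + 19285 + 19626 + 19624 + 19282`, i.e. modulo the member package (OPEN, unrefereed)
  and four PUBLISHED support items, THE open input of K2 IS the residual pair of cruxes `RamNoErratumDataAtFive` (REST‴) and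
  `OpenInputNotRam` (¬ram) — the seat's row «the deciding crux shrinks to the ¬(ram) locus [+ REST‴]» as ONE kernel-checked
  implication between route items (via `KernelFromPrintB.openInputIMCBody_of_print_of_coreB_of_rest3_of_notRam`, bdp g17 p507129).
The crux certificate is the route's own `have h3 := …` term (Σ-data by
`P2.RoadFF.sigmaDataAtErratumDataB_of_sigmaLocal_of_prop323_of_thm331`, Fitting frame by
`P2.RoadFF.fittingCongruenceFrameAtErratumDataB_of_members_of_prop323`, cut `P2.imcDivIntCoreFrameAtErratumDataB_of_roadFF_fitting`)
with `hloc` and Shapiro supplied by the theorems; only the closing module `ErratumRoadFiveJSWSigmaLocalCharIdeal` (which carries the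
Literature-named `…_proved`) and the route file are imported.

HONEST FRAMING: certificates «item ⟸ items»; CONDITIONAL on the named items, one of which (the member package: Castella's
erratum (2.4)–(2.5) via [FW21, Thm. 4.41], a preprint) is OPEN and unrefereed; nothing is booked; the anticyclotomic main
conjecture is asserted nowhere; BSD is proved for no pair; no census number moves (T7).

References: [Castella2018Erratum] (2.4)–(2.5), proof of Thm. 1.1 (pp. 3–4); [FouquetWan2021] Thm. 4.41 (claim);
[JetchevSkinnerWan2017] Thm. 3.3.1, proof of Thm. 6.1.6; [SkinnerUrban2014] Prop. 3.2.3; [Castella2018Exceptional] Thms. 2.10–2.11;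
[Wuthrich2014] Prop. 21; cell files `Theorems/ErratumRoadFiveIMCDivAtErratumDataAllROfSigmaLocal.lean` (g12),
`Theorems/ErratumRoadFiveJSWSigmaLocalCharIdeal.lean` (g14), `Theorems/ErratumRoadFiveKernelFromPrintB.lean` (bdp g17).
-/

set_option autoImplicit false
-- the Theorems namespace of this sub repeats the summit name by design (D-0017 nested layout)
set_option linter.dupNamespace false

noncomputable section

open scoped Classical
open WeierstrassCurve NumberField IsDedekindDomain
open Literature.NumberTheory.EllipticCurves Literature.NumberTheory.EllipticCurves.ModularForms
  Literature.NumberTheory.EllipticCurves.Rank1Residual Literature.NumberTheory.EllipticCurves.JetchevSkinnerWan2017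
  Literature.NumberTheory.EllipticCurves.Castella2018
open Summit.BirchSwinnertonDyer.Rank1Residual.X11b
open Summit.BirchSwinnertonDyer.BirchSwinnertonDyer.Theses.ErratumRoadFive

namespace Summit.BirchSwinnertonDyer.BirchSwinnertonDyer.Theorems

/-- **Crux 20169 `IMCDivAtErratumDataAllR` BY NAME from crux 20529 `CastellaErratumMemberPackage` (OPEN) + support 19626
`JSWAnticyclotomicControlMult` + GZK + modularity** — the local `Σ`-atom and Shapiro being THEOREMS of the tree
(`sigmaLocal_charIdeal_eulerFactor_mem_of_noTamagawaDefect_proved`, `SkinnerUrban2014.prop323_XAc_equiv_XBigDecomp_holds`).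
CONDITIONAL on the named inputs (one OPEN, unrefereed); nothing booked.
[claim: Castella2018Erratum, status: under-review] [claim: FouquetWan2021, status: under-review]
[cite: Castella2018Erratum, (2.4)–(2.5) and proof of Thm. 1.1 (pp. 3–4)]
[cite: JetchevSkinnerWan2017, Thm. 3.3.1 with §3.5 (3.5.c); proof of Thm. 6.1.6 (local display)] -/
theorem imcDivAtErratumDataAllR_of_memberPackage (hMem : CastellaErratumMemberPackage) (h331 : JSWAnticyclotomicControlMult)
    (hGZK : rank_eq_analyticRank_of_analyticRank_le_one) (hnf : exists_isNewformOf) : IMCDivAtErratumDataAllR :=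
  fun W _ _ p _ ↦
    P2.imcDivIntCoreFrameAtErratumDataB_of_roadFF_fitting
      (P2.RoadFF.sigmaDataAtErratumDataB_of_sigmaLocal_of_prop323_of_thm331 W p
        sigmaLocal_charIdeal_eulerFactor_mem_of_noTamagawaDefect_proved
        SkinnerUrban2014.prop323_XAc_equiv_XBigDecomp_holds h331 hGZK hnf)
      (P2.RoadFF.fittingCongruenceFrameAtErratumDataB_of_members_of_prop323 hMem
        SkinnerUrban2014.prop323_XAc_equiv_XBigDecomp_holds W p)

/-- **Crux 20169 BY NAME from three ITEMS of the route: `20169 ⟸ 20529 + 19626 + 19283`** (GZK = conjunct 2 and modularity =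
conjunct 4 of support 19283 `PublishedInputsIMCReduction`). CONDITIONAL; nothing booked.
[claim: Castella2018Erratum, status: under-review] [claim: FouquetWan2021, status: under-review]
[cite: Castella2018Erratum, (2.4)–(2.5) and proof of Thm. 1.1 (pp. 3–4)] [cite: JetchevSkinnerWan2017, Thm. 3.3.1] -/
theorem imcDivAtErratumDataAllR_of_memberPackage_of_items (hMem : CastellaErratumMemberPackage)
    (h331 : JSWAnticyclotomicControlMult) (hF : PublishedInputsIMCReduction) : IMCDivAtErratumDataAllR :=
  imcDivAtErratumDataAllR_of_memberPackage hMem h331 hF.2.1 hF.2.2.2.1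

/-- **The parent 19061 `OpenInputIMC` BY NAME from seven ITEMS of the route:
`19061 ⟸ 20529 + 19625 + 19283 + 19285 + 19626 + 19624 + 19282`** — modulo the member package (OPEN) and four PUBLISHED support
items (BDP value continuity at `𝟙`, the held published inputs, Wuthrich's `Ш ∣ Ш_an`, JSW17 Thm. 3.3.1), THE open input of K2 at every
X11b pair `p ≥ 5` IS the pair of residual cruxes REST‴ (`RamNoErratumDataAtFive`) and ¬ram (`OpenInputNotRam`). Composition of
`imcDivAtErratumDataAllR_of_memberPackage_of_items` with bdp's `KernelFromPrintB.openInputIMCBody_of_print_of_coreB_of_rest3_of_notRam`.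
CONDITIONAL; nothing booked; BSD is proved for no pair.
[claim: Castella2018Erratum, status: under-review] [claim: FouquetWan2021, status: under-review]
[cite: Castella2018Erratum, Thm. 1.1 and proof (pp. 1–4)] [cite: Castella2018Exceptional, Thms. 2.10–2.11]
[cite: Wuthrich2014, Prop. 21] [cite: JetchevSkinnerWan2017, Thm. 3.3.1 with §3.5 (3.5.c)] -/
theorem openInputIMC_of_memberPackage_of_rest3_of_notRam (hMem : CastellaErratumMemberPackage)
    (hVN : BDPValueContinuityInput) (hF : PublishedInputsIMCReduction) (hWu : WuthrichShaDividesAnalyticSha)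
    (h331 : JSWAnticyclotomicControlMult) (hrest : RamNoErratumDataAtFive) (hOff : OpenInputNotRam) : OpenInputIMC := by
  intro W _ _ p _
  exact KernelFromPrintB.openInputIMCBody_of_print_of_coreB_of_rest3_of_notRam hVN
    (imcDivAtErratumDataAllR_of_memberPackage_of_items hMem h331 hF) hF hWu h331 hrest hOff W p

end Summit.BirchSwinnertonDyer.BirchSwinnertonDyer.Theorems

end
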